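import Summits.AtomisticToContinuum.Crystallization.Theorems.FrustratedLawDichotomyCellTEQ15Data

/-!
# FrustratedLawDichotomy · crux `AperiodicFrustratedLawGap` (stmt-AtomisticToContinuum-27623) — TEQ15 witness cell: class 0 sums D
# (decomp-a2c, prover hand 2, generation 17; each theorem ONE `decide +kernel`, split for the farm's per-declaration budget). [folklore]
-/

namespace Summit.AtomisticToContinuum.Crystallization.Theorems.FrustratedLawDichotomyCellTEQ15

open scoped BigOperators
open Summit.AtomisticToContinuum.Crystallization.Theorems.FrustratedLawDichotomyCellChecker
open Summit.AtomisticToContinuum.Crystallization.Theorems.FrustratedLawDichotomyCellKitX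

set_option maxHeartbeats 0 in
/-- Kernel value of the `B1` sum of class `0`. [folklore] -/
theorem teq15_sum0_B1 : sumX cellTEQ15 (termB cellTEQ15 cellTEQ15P cellTEQ15X0.bins 1 ⟨0, by decide⟩) = ((-142966951989 : ℚ) / 262144000000) := by decide +kernel

set_option maxHeartbeats 0 in
/-- Kernel value of the `B2` sum of class `0`. [folklore] -/
theorem teq15_sum0_B2 : sumX cellTEQ15 (termB cellTEQ15 cellTEQ15P cellTEQ15X0.bins 2 ⟨0, by decide⟩) = ((19699224427 : ℚ) / 26214400000) := by decide +kernel

set_option maxHeartbeats 0 in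
/-- Kernel value of the `C4` sum of class `0`. [folklore] -/
theorem teq15_sum0_C4 : sumX cellTEQ15 (termC4 cellTEQ15 cellTEQ15P cellTEQ15X0.bins ⟨0, by decide⟩) = ((5318301 : ℚ) / 524288) := by decide +kernel

end Summit.AtomisticToContinuum.Crystallization.Theorems.FrustratedLawDichotomyCellTEQ15
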